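import Literature.NumberTheory.GaloisRepresentations.WeilDeligneRep
import Literature.NumberTheory.GaloisRepresentations.WeilGroupFrobeniusPowers
import Literature.NumberTheory.Automorphic.LocalConstantsInflation
import Literature.RepresentationTheory.Semisimple.EquivOfCharacter
import Literature.RepresentationTheory.FiniteGroups.TracePowCharpoly
import Literature.AlgebraicGeometry.Motives.FaltingsECSemisimpleNumberFieldProofs
import HarnessLib

/-!
# Line `Sketch` for the crux `ReciprocityUpToIrreducibility` (item stmt-Langlands-14328), continuation c5:
# uniqueness of the unramified Frobenius-semisimple Weil–Deligne parameter (stub H1)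

Support file (closes nothing; registered stub `stub_wdUnramified_isEquivalent_of_charpoly_eq` of
line `Sketch`, wave N4 of continuation lead c5).

Two Weil–Deligne representations of `W_F` on `ℂⁿ` with `N = 0`, trivial on inertia and
Frobenius-semisimple, whose values at ONE geometric Frobenius `Φ` (`deg Φ = -1`) have the same
characteristic polynomial, are isomorphic.  Proof: the semisimple endomorphisms `ρ₁(Φ)`, `ρ₂(Φ)` of
`ℂⁿ` have equal characteristic polynomials, hence are conjugate
(`exists_linearEquiv_conj_of_isSemisimple_of_charpoly_eq_wdH1`: Brauer–Nesbitt in characteristic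
zero, `Representation.nonempty_equiv_of_character_eq_of_isSemisimple`, for the two semisimple
representations `k ↦ ρᵢ(Φ)ᵏ` of the monoid `ℕ`, whose characters `tr ρᵢ(Φ)ᵏ = Σ_μ mult_μ · μᵏ`
agree by `TracePow.trace_pow_eq_sum_rootMultiplicity`); a linear isomorphism intertwining `ρ₁(Φ)`
with `ρ₂(Φ)` and (trivially) the two trivial inertia actions intertwines `ρ₁` with `ρ₂` on all of
`W_F = ⟨Φ, I_F⟩` (`WeilGroup.intertwines_of_inertia_of_frob`); and `N = 0` on both sides
(`WeilDeligneRep.isEquivalent_of_repEquiv`).  No definitions; std axioms.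

References: J. Tate, *Number theoretic background*, Corvallis 1979, (4.1.3)–(4.1.6)
[TateCorvallis1979]; N. Bourbaki, *Algèbre* VIII (2012), § 20 n° 6 [BourbakiAlgebreVIII2012].
-/

noncomputable section

set_option linter.dupNamespace false -- project-wide option (lakefile weak.linter.dupNamespace); `Summit.Langlands.Langlands` is the mandated namespace

open scoped Matrix Classical Polynomial
open Polynomial
open Literature.NumberTheory.Automorphic Literature.NumberTheory.GaloisRepresentations

namespace Summit.Langlands.Langlands.Theorems.ReciprocityUpToIrreducibility

/-- **Semisimple endomorphisms with the same characteristic polynomial are conjugate** (over an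
algebraically closed field of characteristic zero).  If `T₁`, `T₂` are semisimple endomorphisms of a
finite-dimensional `K`-vector space `V` with `χ_{T₁} = χ_{T₂}`, there is a linear automorphism `e`
of `V` with `e ∘ T₁ = T₂ ∘ e`: the representations `k ↦ Tᵢᵏ` of the monoid `ℕ` are semisimple
(`Tᵢ` has squarefree minimal polynomial and every `Tᵢᵏ` is a polynomial in `Tᵢ`,
`isSemisimpleRepresentation_of_forall_mem_adjoin_singleton`) with equal characters
`tr Tᵢᵏ = Σ_μ mult_μ(χ) μᵏ` (`TracePow.trace_pow_eq_sum_rootMultiplicity`), hence equivalent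
(Brauer–Nesbitt in characteristic zero, `Representation.nonempty_equiv_of_character_eq_of_isSemisimple`).
[cite: BourbakiAlgebreVIII2012, VIII § 20 n° 6, Cor. a) de la Prop. 6] -/
theorem exists_linearEquiv_conj_of_isSemisimple_of_charpoly_eq_wdH1 {K : Type*} [Field K]
    [IsAlgClosed K] [CharZero K] {V : Type*} [AddCommGroup V] [Module K V] [FiniteDimensional K V]
    {T₁ T₂ : Module.End K V} (h₁ : T₁.IsSemisimple) (h₂ : T₂.IsSemisimple)
    (h : T₁.charpoly = T₂.charpoly) :
    ∃ e : V ≃ₗ[K] V, (e : V →ₗ[K] V) ∘ₗ T₁ = T₂ ∘ₗ (e : V →ₗ[K] V) := by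
  classical
  -- the representations `k ↦ Tᵢ ^ k` of the monoid `ℕ`
  let σ : Module.End K V → Representation K (Multiplicative ℕ) V := fun T =>
    powersHom (Module.End K V) T
  have hsemi : ∀ T : Module.End K V, T.IsSemisimple → (σ T).IsSemisimpleRepresentation :=
    fun T hT =>
      Literature.AlgebraicGeometry.Motives.isSemisimpleRepresentation_of_forall_mem_adjoin_singleton
        (σ T) T hT.minpoly_squarefree (minpoly.aeval K T) fun g => by
          simpa only [σ, powersHom_apply] using
            pow_mem (Algebra.self_mem_adjoin_singleton K T) g.toAdd
  haveI := hsemi T₁ h₁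
  haveI := hsemi T₂ h₂
  have hch : (σ T₁).character = (σ T₂).character := by
    funext g
    simp only [Representation.character, σ, powersHom_apply]
    rw [Literature.RepresentationTheory.FiniteGroups.TracePow.trace_pow_eq_sum_rootMultiplicity T₁ h₁,
      Literature.RepresentationTheory.FiniteGroups.TracePow.trace_pow_eq_sum_rootMultiplicity T₂ h₂, h]
  obtain ⟨e⟩ :=
    Literature.RepresentationTheory.Semisimple.Representation.nonempty_equiv_of_character_eq_of_isSemisimple
      (σ T₁) (σ T₂) hch
  refine ⟨e.toLinearEquiv, ?_⟩
  have he := e.isIntertwining' (Multiplicative.ofAdd 1)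
  simpa only [σ, powersHom_apply, toAdd_ofAdd, pow_one] using he

/-- **stub H1 (uniqueness of the unramified Frobenius-semisimple parameter).**  Two Weil–Deligne
representations of `W_F` on `ℂⁿ` with `N = 0`, trivial on inertia and Frobenius-semisimple, whose
values at one geometric Frobenius `Φ` (`deg Φ = -1`) have the same characteristic polynomial, are
isomorphic: the semisimple `ρ₁(Φ)`, `ρ₂(Φ)` with equal characteristic polynomials are conjugate by a
linear automorphism `e` (`exists_linearEquiv_conj_of_isSemisimple_of_charpoly_eq_wdH1`, Brauer–Nesbitt
for the monoid `ℕ`), `e` intertwines the trivial inertia actions, hence all of `ρ₁`, `ρ₂`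
(`W_F = ⟨Φ, I_F⟩`, `WeilGroup.intertwines_of_inertia_of_frob`), and `N = 0` on both sides
(`WeilDeligneRep.isEquivalent_of_repEquiv`). [cite: TateCorvallis1979, (4.1.3)–(4.1.6)]
[cite: BourbakiAlgebreVIII2012, VIII § 20 n° 6, Thm. 2, Cor. 1] -/
theorem stub_wdUnramified_isEquivalent_of_charpoly_eq :
    ∀ (F : Type) [Field F] [ValuativeRel F] [TopologicalSpace F] [IsNonarchimedeanLocalField F]
      (n : ℕ) (r₁ r₂ : WeilDeligneRep F ℂ (Fin n → ℂ)) (Φ : WeilGroup F), WeilGroup.deg Φ = -1 →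
      r₁.N = 0 → r₂.N = 0 → WeilGroup.IsUnramifiedRep r₁.ρ → WeilGroup.IsUnramifiedRep r₂.ρ →
      r₁.IsFrobSemisimple → r₂.IsFrobSemisimple →
      (r₁.ρ Φ).charpoly = (r₂.ρ Φ).charpoly → r₁.IsEquivalent r₂ := by
  intro F _ _ _ _ n r₁ r₂ Φ hΦ hN₁ hN₂ hu₁ hu₂ hs₁ hs₂ hchar
  -- a linear automorphism conjugating `ρ₁(Φ)` to `ρ₂(Φ)`
  obtain ⟨e, he⟩ :=
    exists_linearEquiv_conj_of_isSemisimple_of_charpoly_eq_wdH1 (hs₁ Φ) (hs₂ Φ) hchar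
  -- it intertwines `ρ₁`, `ρ₂` on inertia (both trivial), hence on all of `W_F`
  have hall : ∀ w : WeilGroup F,
      (e : (Fin n → ℂ) →ₗ[ℂ] (Fin n → ℂ)) * r₁.ρ w = r₂.ρ w * (e : (Fin n → ℂ) →ₗ[ℂ] (Fin n → ℂ)) :=
    WeilGroup.intertwines_of_inertia_of_frob (M := Module.End ℂ (Fin n → ℂ)) r₁.ρ r₂.ρ
      (e : (Fin n → ℂ) →ₗ[ℂ] (Fin n → ℂ)) hΦ he
      (fun u hu => by rw [hu₁ u hu, hu₂ u hu, mul_one, one_mul])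
  exact WeilDeligneRep.isEquivalent_of_repEquiv r₁ r₂ hN₁ hN₂ (Representation.Equiv.mk e hall)

end Summit.Langlands.Langlands.Theorems.ReciprocityUpToIrreducibility

end
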